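import Mathlib
import Literature.NumberTheory.Irrationality.LaiSprangZudilin2026.PartialFractions
import HarnessLib

/-!
# Lai–Sprang–Zudilin 2026, Lemma 5.1 PROVED: `d_n·ρ_{n,3} ∈ ℤ` and `d_n⁶·ρ_{n,0} ∈ ℤ`

Topic `Literature/NumberTheory/Irrationality/LaiSprangZudilin2026`.  Source: L. Lai, J. Sprang, W. Zudilin,
*A note on the irrationality of `ζ₂(5)`*, IMRN **2026**:16, rnag180 = arXiv:2505.05005 [LaiSprangZudilin2026], §5
(held text `paper:arxiv-2505.05005`, pp. 8–9, read on the page).  Proofs-only companion of `PartialFractions.lean`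
(the coefficients `r_{n,i,k}` = `coeffR`, `ρ_{n,0}` = `pfRho0`, `ρ_{n,3}` = `pfRho3`) discharging the named fact
`lemma51` of `SecondSolution.lean` (`lemma51_holds`).  No definition, no named fact is introduced.

## Source, as printed

«Note that building blocks of the rational function `R_n(t)` are rational functions `2t+n`,
`F(t) = 2^{2n}(t+½)_n/n!` and `G(t) = n!/(t)_{n+1}`.  Applying a somewhat standard argument based on their
properties (see [Lai2025+b] and [Zud2004]) and adapting the strategy of the proof of [FSZ2019] (as in [Lai2025]), it
is elementary to establish the following inclusions.  **Lemma 5.1.** For `n ∈ ℤ_{>0}`, `d_n·ρ_{n,3} ∈ ℤ` and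
`d_n⁶·ρ_{n,0} ∈ ℤ`.»  (`d_n = lcm(1,…,n)`.)

## The proof formalised here

* `d_n^{4−i} r_{n,i,k} ∈ ℤ` — Leibniz over the bricks (`PartialFractions.Rreg_isDInt`: the half-integer brick
  `2^{2n}(t+½)_n/n!` is an integer-valued polynomial, [Zudilin2004, Lemma 16] for `n!(t+k)/(t)_{n+1}`); hence
  `d_n ρ_{n,3} = 384 Σ_k d_n r_{n,3,k} ∈ ℤ` (`exists_int_lcm_mul_pfRho3`).
* For `ρ_{n,0} = −Σ_{k,i} i(i+1) r_{n,i,k} Σ_{ℓ=1}^{k}(ℓ−½)^{−(i+2)}` the half-integers `ℓ − ½`, `ℓ ≤ n`, have odd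
  numerators up to `2n−1`, which `d_n` does not clear.  The «strategy of [FSZ2019]» — use the ZEROS of `R_n` — is
  implemented in the form given to it by Rivoal–Zudilin for the same shape of sum ([RivoalZudilin2020, §3, proof
  of Proposition 1 (ii), display (12)]; tree: `RivoalZudilin2020.DenominatorsProofs.isZ_qZeroHat`): `R_n` has a
  quadruple zero at `−u−½` for `u < n`, so `R_n″(−u−½) = 0`, i.e. by (def_rik)
  `Σ_{k,i} i(i+1) r_{n,i,k}(k−u−½)^{−(i+2)} = 0` (`sum_coeffR_half_eq_zero`); adding these for
  `u = 0, …, ω = ⌊(n−1)/2⌋` to (def_rho_0), for each `(k,i)` the surviving half-integers `k−u−½` have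
  `|2k−2u−1| ≤ n`, so `d_n^{i+2}` clears them (`exists_int_bracket`), and `d_n⁶ = d_n^{4−i}·d_n^{i+2}`
  (`exists_int_lcm_pow_mul_pfRho0`).
* `lemma51_holds` — through the bridge `pfRho0_eq_rho0`, `pfRho3_eq_rho3` of `PartialFractions.lean`.

HONEST FRAMING (cell zeta5-irr): this is the denominator Lemma 5.1 as printed (the weaker companion of the open
expectation (5.2) «den-con» `d_n⁵ρ_{n,0} ∈ ℤ`, which is NOT touched); nothing here concerns `ζ(5)` or `ζ₂(5)` itself.
-/

noncomputable section

open Finset Filter Topology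
open Literature.Analysis.Calculus
open Literature.NumberTheory.Transcendental
open scoped Nat

namespace Literature.NumberTheory.Irrationality.LaiSprangZudilin2026

/-! ## The zeros of `R_n` at the half-integers `−u−½`, `u < n` -/

/-- The half-integer points `−u−½` are off the integer poles. [folklore] -/
private theorem neg_half_add_nat_ne_zero (u j : ℕ) : (-(u : ℚ) - 1 / 2) + j ≠ 0 := by
  intro h
  have h2 : (2 * (j : ℤ) - 2 * u - 1 : ℤ) = 0 := by
    have : (2 * (j : ℚ) - 2 * u - 1) = 0 := by linarith
    exact_mod_cast this
  omega

/-- For `u < n`, `R_n(t) = (t+u+½)⁴ · g(t)` with `g` regular at `−u−½` (the factor `j = u` of `(t+½)_n⁴`).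
[cite: LaiSprangZudilin2026, Definition 3.1 (the factor (t+½)_n⁴)] -/
theorem R_eq_pow_mul_half (n : ℕ) {u : ℕ} (hu : u < n) (t : ℚ) :
    R n t = (t - (-(u : ℚ) - 1 / 2)) ^ 4 * (2 ^ (8 * n) * (2 * t + n) *
      (∏ j ∈ (range n).erase u, (t + 1 / 2 + j)) ^ 4 / (∏ j ∈ range (n + 1), (t + j)) ^ 4) := by
  rw [R, ← Finset.mul_prod_erase (range n) (fun j => t + 1 / 2 + (j : ℚ)) (mem_range.2 hu)]
  ring

/-- **`𝒟₂ R_n(−u−½) = 0`** for `u < n`: `R_n` has a quadruple zero at `−u−½` (used as in [RivoalZudilin2020, §3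
(12)]: «`R″(k−½) = 0` for `k = −ω, …, −1, 0`»). [cite: LaiSprangZudilin2026, Definition 3.1 (the factor (t+½)_n⁴)] -/
theorem divDeriv_two_R_half_eq_zero (n : ℕ) {u : ℕ} (hu : u < n) : divDeriv 2 (R n) (-(u : ℚ) - 1 / 2) = 0 := by
  have hden : ∀ j ∈ range (n + 1), (-(u : ℚ) - 1 / 2) + j ≠ 0 := fun j _ => neg_half_add_nat_ne_zero u j
  have hg : ContDiffAt ℚ ((2 : ℕ) : WithTop ℕ∞) (fun t : ℚ => 2 ^ (8 * n) * (2 * t + n) *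
      (∏ j ∈ (range n).erase u, (t + 1 / 2 + j)) ^ 4 / (∏ j ∈ range (n + 1), (t + j)) ^ 4) (-(u : ℚ) - 1 / 2) := by
    refine ContDiffAt.div (by fun_prop) (by fun_prop) ?_
    exact pow_ne_zero _ (prod_ne_zero_iff.2 hden)
  have hger : R n =ᶠ[𝓝 (-(u : ℚ) - 1 / 2)] fun t => (t - (-(u : ℚ) - 1 / 2)) ^ 4 * (2 ^ (8 * n) * (2 * t + n) *
      (∏ j ∈ (range n).erase u, (t + 1 / 2 + j)) ^ 4 / (∏ j ∈ range (n + 1), (t + j)) ^ 4) :=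
    Eventually.of_forall fun t => R_eq_pow_mul_half n hu t
  rw [divDeriv_congr hger, divDeriv_sub_pow_mul hg 4, if_pos (by norm_num)]

/-- **The vanishing sums**: for `u < n`, `Σ_{k ≤ n} Σ_{i=1}^{4} i(i+1) r_{n,i,k} (k−u−½)^{−(i+2)} = 0`
(`R_n″(−u−½) = 0` expanded by (def_rik); the device of [RivoalZudilin2020, §3 (12)] for the `q̂_{0,n}` there).
[cite: LaiSprangZudilin2026, §3 (def_rik) with Definition 3.1; RivoalZudilin2020, §3 (proof of Proposition 1 (ii), (12))] -/
theorem sum_coeffR_half_eq_zero (n : ℕ) {u : ℕ} (hu : u < n) :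
    ∑ k ∈ range (n + 1), ∑ i ∈ (Icc 1 4 : Finset ℕ),
      (i : ℚ) * ((i : ℚ) + 1) * coeffR n i k * (((-(u : ℚ) - 1 / 2 + k)) ^ (i + 2))⁻¹ = 0 := by
  set x₀ : ℚ := -(u : ℚ) - 1 / 2 with hx₀
  have hden : ∀ j ∈ range (n + 1), x₀ + j ≠ 0 := fun j _ => neg_half_add_nat_ne_zero u j
  have hgerm : R n =ᶠ[𝓝 x₀]
      fun t => ∑ k ∈ range (n + 1), ∑ i ∈ Icc 1 4, coeffR n i k * ((t + k) ^ i)⁻¹ :=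
    (eventually_nhds_forall_add_ne_zero (range (n + 1)) hden).mono fun t ht => R_eq_sum_coeffR n ht
  have hterm : ∀ k ∈ range (n + 1), ∀ i ∈ (Icc 1 4 : Finset ℕ),
      ContDiffAt ℚ ((2 : ℕ) : WithTop ℕ∞) (fun t : ℚ => coeffR n i k * ((t + k) ^ i)⁻¹) x₀ := by
    intro k hk i _
    exact contDiffAt_const.mul (((contDiffAt_id.add contDiffAt_const).pow i).inv (pow_ne_zero _ (hden k hk)))
  have hsum : ∀ k ∈ range (n + 1), ContDiffAt ℚ ((2 : ℕ) : WithTop ℕ∞)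
      (fun t : ℚ => ∑ i ∈ Icc 1 4, coeffR n i k * ((t + k) ^ i)⁻¹) x₀ :=
    fun k hk => ContDiffAt.sum fun i hi => hterm k hk i hi
  have hD := divDeriv_two_R_half_eq_zero n hu
  rw [← hx₀, divDeriv_congr hgerm, divDeriv_sum fun k hk => hsum k hk] at hD
  have hD' : ∑ k ∈ range (n + 1), ∑ i ∈ (Icc 1 4 : Finset ℕ),
      coeffR n i k * ((i : ℚ) * (i + 1) / 2 * ((x₀ + k) ^ (i + 2))⁻¹) = 0 := by
    rw [← hD]
    refine sum_congr rfl fun k hk => ?_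
    rw [divDeriv_sum fun i hi => hterm k hk i hi]
    refine sum_congr rfl fun i _ => ?_
    rw [divDeriv_const_mul, divDeriv_two_inv_pow]
  have e : ∑ k ∈ range (n + 1), ∑ i ∈ (Icc 1 4 : Finset ℕ),
      (i : ℚ) * ((i : ℚ) + 1) * coeffR n i k * (((x₀ + k)) ^ (i + 2))⁻¹
      = 2 * ∑ k ∈ range (n + 1), ∑ i ∈ (Icc 1 4 : Finset ℕ),
        coeffR n i k * ((i : ℚ) * (i + 1) / 2 * ((x₀ + k) ^ (i + 2))⁻¹) := by
    rw [mul_sum]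
    refine sum_congr rfl fun k _ => ?_
    rw [mul_sum]
    exact sum_congr rfl fun i _ => by ring
  rw [e, hD', mul_zero]

/-! ## The half-integer denominators cleared by `d_n` -/

/-- For an odd integer `o = 2k − 2u − 1` with `0 < |o| ≤ n`: `d_n^s · (k−u−½)^{−s} = (2d_n/o)^s ∈ ℤ`
([RivoalZudilin2020]: «an analysis similar to [zud2]»; tree: `RivoalZudilin2020.isZ_lcm_pow_mul_inv_half_pow` over `ℝ`).
[cite: LaiSprangZudilin2026, §5 (Lemma 5.1, d_n); RivoalZudilin2020, §3 (proof of Proposition 1 (ii))] -/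
theorem exists_int_lcm_pow_mul_inv_half_pow {n k u : ℕ} (ho : ((2 * (k : ℤ) - 2 * u - 1).natAbs ≤ n)) (s : ℕ) :
    ∃ z : ℤ, (Nat.lcmUpto n : ℚ) ^ s * ((-(u : ℚ) - 1 / 2 + k) ^ s)⁻¹ = z := by
  set o : ℤ := 2 * (k : ℤ) - 2 * u - 1 with hodef
  have ho0 : o ≠ 0 := by omega
  have hdvd : (o.natAbs : ℤ) ∣ (Nat.lcmUpto n : ℤ) := by exact_mod_cast dvd_lcmUpto (Int.natAbs_pos.2 ho0) ho
  have hdvd' : o ∣ (Nat.lcmUpto n : ℤ) := Int.natAbs_dvd.1 hdvd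
  obtain ⟨w, hw⟩ := hdvd'
  refine ⟨(2 * w) ^ s, ?_⟩
  have hcast : (-(u : ℚ) - 1 / 2 + k) = (o : ℚ) / 2 := by rw [hodef]; push_cast; ring
  have hone : (o : ℚ) ≠ 0 := by exact_mod_cast ho0
  have hd : (Nat.lcmUpto n : ℚ) = (o : ℚ) * w := by exact_mod_cast hw
  rw [hcast, hd, ← inv_pow, ← mul_pow]
  push_cast
  congr 1
  field_simp

/-- Re-indexing: `Σ_{ℓ=1}^{k} (ℓ−½)^{−s} = Σ_{u<k} (k−u−½)^{−s}`. [folklore] -/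
private theorem sum_Icc_half_eq_sum_range (k s : ℕ) :
    ∑ ℓ ∈ Icc 1 k, ((((ℓ : ℚ) - 1 / 2)) ^ s)⁻¹ = ∑ u ∈ range k, ((-(u : ℚ) - 1 / 2 + k) ^ s)⁻¹ := by
  refine sum_nbij' (fun ℓ => k - ℓ) (fun u => k - u) ?_ ?_ ?_ ?_ ?_
  · intro ℓ hℓ; have := mem_Icc.1 hℓ; exact mem_range.2 (by omega)
  · intro u hu; have := mem_range.1 hu; exact mem_Icc.2 ⟨by omega, by omega⟩
  · intro ℓ hℓ; have := mem_Icc.1 hℓ; omega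
  · intro u hu; have := mem_range.1 hu; omega
  · intro ℓ hℓ
    have := mem_Icc.1 hℓ
    rw [Nat.cast_sub (by omega)]
    congr 1
    ring

/-- **The bracket**: for `n ≥ 1`, `k ≤ n`, `ω = ⌊(n−1)/2⌋` and every `s`,
`d_n^s · (Σ_{u ≤ ω} (k−u−½)^{−s} − Σ_{ℓ=1}^{k} (ℓ−½)^{−s}) ∈ ℤ` — after cancellation only half-integers `k−u−½`
with `|2k−2u−1| ≤ n` survive (tree, over `ℝ`: `RivoalZudilin2020.isZ_bracket`).
[cite: LaiSprangZudilin2026, §5 (Lemma 5.1); RivoalZudilin2020, §3 (proof of Proposition 1 (ii), (12))] -/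
theorem exists_int_bracket {n : ℕ} (hn : 1 ≤ n) {k : ℕ} (hk : k ≤ n) (s : ℕ) :
    ∃ z : ℤ, (Nat.lcmUpto n : ℚ) ^ s *
      (∑ u ∈ range ((n - 1) / 2 + 1), ((-(u : ℚ) - 1 / 2 + k) ^ s)⁻¹
        - ∑ ℓ ∈ Icc 1 k, ((((ℓ : ℚ) - 1 / 2)) ^ s)⁻¹) = z := by
  set ω := (n - 1) / 2 with hω
  rw [sum_Icc_half_eq_sum_range]
  set f : ℕ → ℚ := fun u => ((-(u : ℚ) - 1 / 2 + k) ^ s)⁻¹ with hf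
  -- integrality of the surviving terms, summed
  have hsumZ : ∀ (S : Finset ℕ), (∀ u ∈ S, ((2 * (k : ℤ) - 2 * u - 1).natAbs ≤ n)) →
      ∃ z : ℤ, (Nat.lcmUpto n : ℚ) ^ s * ∑ u ∈ S, f u = z := by
    intro S hS
    classical
    induction S using Finset.induction_on with
    | empty => exact ⟨0, by simp⟩
    | insert a S ha ih =>
      obtain ⟨z₁, hz₁⟩ := ih fun u hu => hS u (mem_insert_of_mem hu)
      obtain ⟨z₂, hz₂⟩ := exists_int_lcm_pow_mul_inv_half_pow (hS a (mem_insert_self a S)) s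
      refine ⟨z₂ + z₁, ?_⟩
      rw [sum_insert ha, mul_add, hz₁, hf, hz₂]
      push_cast
      ring
  by_cases hcase : k ≤ ω + 1
  · rw [← sum_Ico_eq_sub f hcase]
    exact hsumZ _ fun u hu => by have := mem_Ico.1 hu; omega
  · have hle : ω + 1 ≤ k := by omega
    rw [show (∑ u ∈ range (ω + 1), f u) - ∑ u ∈ range k, f u = -∑ u ∈ Ico (ω + 1) k, f u by
      rw [sum_Ico_eq_sub f hle]; ring, mul_neg]
    obtain ⟨z, hz⟩ := hsumZ (Ico (ω + 1) k) fun u hu => by have := mem_Ico.1 hu; omega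
    exact ⟨-z, by rw [hz]; push_cast; ring⟩

/-! ## Lemma 5.1 -/

/-- **`d_n · ρ_{n,3} ∈ ℤ`** (the printed `ρ_{n,3}` of (def_rho_3)): `384 Σ_k d_n r_{n,3,k}` with `d_n r_{n,3,k} ∈ ℤ`.
[cite: LaiSprangZudilin2026, Lemma 5.1 (first inclusion)] -/
theorem exists_int_lcm_mul_pfRho3 (n : ℕ) : ∃ z : ℤ, (Nat.lcmUpto n : ℚ) * pfRho3 n = z := by
  classical
  have hterm : ∀ k ∈ range (n + 1), ∃ z : ℤ, (Nat.lcmUpto n : ℚ) * coeffR n 3 k = z := by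
    intro k hk
    have h := exists_int_lcm_pow_mul_coeffR n (k := k) (by have := mem_range.1 hk; omega) 3
    simpa using h
  have hsum : ∀ (S : Finset ℕ), S ⊆ range (n + 1) →
      ∃ z : ℤ, (Nat.lcmUpto n : ℚ) * ∑ k ∈ S, coeffR n 3 k = z := by
    intro S hS
    induction S using Finset.induction_on with
    | empty => exact ⟨0, by simp⟩
    | insert a S ha ih =>
      obtain ⟨z₁, hz₁⟩ := ih fun u hu => hS (mem_insert_of_mem hu)
      obtain ⟨z₂, hz₂⟩ := hterm a (hS (mem_insert_self a S))
      exact ⟨z₂ + z₁, by rw [sum_insert ha, mul_add, hz₁, hz₂]; push_cast; ring⟩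
  obtain ⟨z, hz⟩ := hsum (range (n + 1)) le_rfl
  refine ⟨384 * z, ?_⟩
  rw [pfRho3, mul_left_comm, hz]
  push_cast
  ring

/-- **`d_n⁶ · ρ_{n,0} ∈ ℤ`** for `n ≥ 1` (the printed `ρ_{n,0}` of (def_rho_0)), by the vanishing sums
`R_n″(−u−½) = 0`, `u ≤ ⌊(n−1)/2⌋`, added to (def_rho_0). [cite: LaiSprangZudilin2026, Lemma 5.1 (second inclusion)] -/
theorem exists_int_lcm_pow_mul_pfRho0 {n : ℕ} (hn : 1 ≤ n) :
    ∃ z : ℤ, (Nat.lcmUpto n : ℚ) ^ 6 * pfRho0 n = z := by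
  classical
  set ω := (n - 1) / 2 with hω
  set D : ℚ := (Nat.lcmUpto n : ℚ) ^ 6 with hD
  set Su : ℕ → ℕ → ℚ := fun i k => ∑ u ∈ range (ω + 1), ((-(u : ℚ) - 1 / 2 + k) ^ (i + 2))⁻¹ with hSu
  set Sk : ℕ → ℕ → ℚ := fun i k => ∑ ℓ ∈ Icc 1 k, ((((ℓ : ℚ) - 1 / 2)) ^ (i + 2))⁻¹ with hSk
  -- the vanishing sum, with the `u`-sum inside
  have hzero : ∑ k ∈ range (n + 1), ∑ i ∈ (Icc 1 4 : Finset ℕ),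
      (i : ℚ) * ((i : ℚ) + 1) * coeffR n i k * Su i k = 0 := by
    have h := sum_eq_zero (s := range (ω + 1)) fun u hu =>
      sum_coeffR_half_eq_zero n (u := u) (by have := mem_range.1 hu; omega)
    rw [sum_comm] at h
    rw [← h]
    refine sum_congr rfl fun k _ => ?_
    rw [sum_comm]
    refine sum_congr rfl fun i _ => ?_
    rw [hSu, mul_sum]
  -- (def_rho_0) with the `ℓ`-sums collected
  have hrho : pfRho0 n = -∑ k ∈ range (n + 1), ∑ i ∈ (Icc 1 4 : Finset ℕ),
      (i : ℚ) * ((i : ℚ) + 1) * coeffR n i k * Sk i k := by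
    rw [pfRho0_eq_sum_halfInvPowSum]
    rfl
  -- combine
  have key : D * pfRho0 n = ∑ k ∈ range (n + 1), ∑ i ∈ (Icc 1 4 : Finset ℕ),
      ((i : ℚ) * ((i : ℚ) + 1)) * ((Nat.lcmUpto n : ℚ) ^ (4 - i) * coeffR n i k) *
        ((Nat.lcmUpto n : ℚ) ^ (i + 2) * (Su i k - Sk i k)) := by
    have h1 : D * pfRho0 n = D * pfRho0 n + D * ∑ k ∈ range (n + 1), ∑ i ∈ (Icc 1 4 : Finset ℕ),
        (i : ℚ) * ((i : ℚ) + 1) * coeffR n i k * Su i k := by rw [hzero, mul_zero, add_zero]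
    rw [h1, hrho, mul_neg, neg_add_eq_sub, mul_sum, mul_sum, ← sum_sub_distrib]
    refine sum_congr rfl fun k _ => ?_
    rw [mul_sum, mul_sum, ← sum_sub_distrib]
    refine sum_congr rfl fun i hi => ?_
    have hi' := mem_Icc.1 hi
    have hsplit : D = (Nat.lcmUpto n : ℚ) ^ (4 - i) * (Nat.lcmUpto n : ℚ) ^ (i + 2) := by
      rw [hD, ← pow_add]; congr 1; omega
    rw [hsplit]
    ring
  -- every term is an integer
  have hterm : ∀ k ∈ range (n + 1), ∀ i ∈ (Icc 1 4 : Finset ℕ), ∃ z : ℤ,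
      ((i : ℚ) * ((i : ℚ) + 1)) * ((Nat.lcmUpto n : ℚ) ^ (4 - i) * coeffR n i k) *
        ((Nat.lcmUpto n : ℚ) ^ (i + 2) * (Su i k - Sk i k)) = z := by
    intro k hk i _
    have hk' : k ≤ n := by have := mem_range.1 hk; omega
    obtain ⟨z₁, hz₁⟩ := exists_int_lcm_pow_mul_coeffR n hk' i
    obtain ⟨z₂, hz₂⟩ := exists_int_bracket hn hk' (i + 2)
    refine ⟨(i : ℤ) * ((i : ℤ) + 1) * z₁ * z₂, ?_⟩
    rw [hz₁, hSu, hSk, hz₂]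
    push_cast
    ring
  -- sum up
  have hsum2 : ∀ (S : Finset (ℕ × ℕ)), S ⊆ range (n + 1) ×ˢ (Icc 1 4 : Finset ℕ) →
      ∃ z : ℤ, ∑ p ∈ S, ((p.2 : ℚ) * ((p.2 : ℚ) + 1)) * ((Nat.lcmUpto n : ℚ) ^ (4 - p.2) * coeffR n p.2 p.1) *
        ((Nat.lcmUpto n : ℚ) ^ (p.2 + 2) * (Su p.2 p.1 - Sk p.2 p.1)) = z := by
    intro S hS
    induction S using Finset.induction_on with
    | empty => exact ⟨0, by simp⟩
    | insert a S ha ih =>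
      obtain ⟨z₁, hz₁⟩ := ih fun u hu => hS (mem_insert_of_mem hu)
      have ha' := mem_product.1 (hS (mem_insert_self a S))
      obtain ⟨z₂, hz₂⟩ := hterm a.1 ha'.1 a.2 ha'.2
      exact ⟨z₂ + z₁, by rw [sum_insert ha, hz₁, hz₂]; push_cast; ring⟩
  obtain ⟨z, hz⟩ := hsum2 (range (n + 1) ×ˢ (Icc 1 4 : Finset ℕ)) le_rfl
  refine ⟨z, ?_⟩
  rw [key, ← hz, sum_product]

/-- **Lai–Sprang–Zudilin 2026, Lemma 5.1** — the named fact `lemma51` of `SecondSolution.lean` is a THEOREM: for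
`n ≥ 1`, `d_n·ρ_{n,3} ∈ ℤ` and `d_n⁶·ρ_{n,0} ∈ ℤ` (`ρ_{n,3} = rho3 n`, `ρ_{n,0} = rho0 n`, which by
`pfRho3_eq_rho3` / `pfRho0_eq_rho0` are the printed (def_rho_3)/(def_rho_0)). [cite: LaiSprangZudilin2026, Lemma 5.1] -/
theorem lemma51_holds : lemma51 := by
  intro n hn
  refine ⟨?_, ?_⟩
  · rw [← pfRho3_eq_rho3]; exact exists_int_lcm_mul_pfRho3 n
  · rw [← pfRho0_eq_rho0]; exact exists_int_lcm_pow_mul_pfRho0 hn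

/-- Lemma 5.4 with Lemma 5.1 discharged: `Π_n^{−1} d_n⁶ ρ_{n,0} ∈ ℤ` now rests on Lemma 5.3 alone.
[cite: LaiSprangZudilin2026, Lemma 5.4] -/
theorem lemma54_of_lemma53 (h53 : lemma53) {n : ℕ} (hn : 1 ≤ n) :
    ∃ z : ℤ, (Nat.lcmUpto n : ℚ) ^ 6 / (primeProd n : ℚ) * rho0 n = z :=
  lemma54_of lemma51_holds h53 hn

end Literature.NumberTheory.Irrationality.LaiSprangZudilin2026
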